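import Summits.ABC.StewartYu.RecordExitsGeneric
import Summits.ABC.StewartYu.RecordExitBGeneric
import Summits.ABC.StewartYu.RecordExitCGeneric
import HarnessLib

/-!
# Cell abc-stewartyu, Gen-3 record (WP-M3.R): `RecordTwo` / `RecordOdd` from END FACTS ONLY — the record-agnostic
# capstone (v1 `PadicG3Par`, v2 `PadicG3ParG`, or any later parameter family)

`Summits/ABC/StewartYu/RecordGeneric.lean` — cell `abc-stewartyu` (HOME `run/shared/lean/pub/abc-stewartyu/`),
route `PadicPrimesKummerThird`, cruxes `Y07Odd` (stmt-ABC-19658) / `Y07Two` (stmt-ABC-19659); seat lp-1 (g2).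
Theorems only.

`recordTwo_of_facts` / `recordOdd_of_facts`: the record predicates `GenThreeFrameSpecTwo.RecordTwo` /
`GenThreeFrameSpecOdd.RecordOdd C (p) n V Vmax W D₀ S₀ X_f D` for ANY END data, from scalar facts about
`(L, S₀, X, X_f, D₀, D)` and four free real scales `ρ` (END degree scale), `K` (class count), `c` (Siegel
constant, `≤ 87ⁿ`), `T` (range scale) — the union of the hypotheses of `exitA_of` (p489575), `exitB_of`
(`RecordExitBGeneric`), `exitC_two_of/exitC_odd_of` (p489843) — with the box constant `Λ := ρ + Vmax` and
`Dmax := ⌊L/2^{n+22}⌋ + 1` derived here.  The v1 record's `PadicG3Par.recordTwo/recordOdd` are the instance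
`(L, ρ, K, c, T) = (P.L, N_qL/2^Ŝ, P.K, Cbⁿ, 2^{Ŝ−1})`; the v2 record (`PadicG3ParG`, gain-divided scale `Lg`,
`c = Cbⁿ/gⁿ`) is the instance its END facts provide (STATUS lp-1 2026-08-27T03:0xZ).

References: Yu. V. Nesterenko, LNM 1819 (2003), §5.2 (5.13)–(5.22), Lemmas 5.3, 5.4.
-/

noncomputable section

open Finset Real Nat

namespace Summit.ABC.StewartYu

namespace RecordExitsNumeric

open PadicG3Par (Cb)
open Summit.ABC.StewartYu.GenThreeFrameSpecTwo (RecordTwo)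
open Summit.ABC.StewartYu.GenThreeFrameSpecOdd (RecordOdd)

/-- `Dⱼ ≤ ⌊L/2^{n+22}⌋ + 1` from `Dⱼ ≤ ρ/Vⱼ + 1`, `Vⱼ ≥ 1`, `ρ < L/2^{n+23}`. [cite: Nesterenko2003, §5.2 (5.17)] -/
theorem D_le_Dmax_of {n : ℕ} {V : Fin n → ℝ} (hV1 : ∀ j, 1 ≤ V j) {D : Fin n → ℕ} {ρ : ℝ} {L : ℕ}
    (hDρ : ∀ j, (D j : ℝ) ≤ ρ / V j + 1) (hρ1 : 1 ≤ ρ) (hρ : ρ < (L : ℝ) / 2 ^ (n + 23)) (j : Fin n) :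
    D j ≤ L / 2 ^ (n + 22) + 1 := by
  have h1 := hDρ j
  have h2 : ρ / V j ≤ ρ := div_le_self (by linarith) (hV1 j)
  -- `⌊L/2^{n+22}⌋ ≥ L/2^{n+22} - 1 = 2 L/2^{n+23} - 1 ≥ ρ + (ρ - 1) ≥ ρ`
  have hq : ((L : ℝ)) / 2 ^ (n + 22) - 1 < ((L / 2 ^ (n + 22) : ℕ) : ℝ) := by
    have h := Nat.lt_div_mul_add (a := L) (b := 2 ^ (n + 22)) (by positivity)
    have h' : (L : ℝ) < ((L / 2 ^ (n + 22) : ℕ) : ℝ) * 2 ^ (n + 22) + 2 ^ (n + 22) := by exact_mod_cast h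
    rw [div_sub_one (by positivity), div_lt_iff₀ (by positivity)]
    linarith
  have e : ((L : ℝ)) / 2 ^ (n + 22) = 2 * ((L : ℝ) / 2 ^ (n + 23)) := by
    rw [show (2 : ℝ) ^ (n + 23) = 2 ^ (n + 22) * 2 by ring]; field_simp
  have h3 : (D j : ℝ) < ((L / 2 ^ (n + 22) : ℕ) : ℝ) + 2 := by linarith
  have h4 : D j < L / 2 ^ (n + 22) + 2 := by exact_mod_cast h3
  omega

/-- **`RecordOdd` from END facts only** (any `p`, any admissible `C`). [cite: Nesterenko2003, §5.2 (5.13)–(5.22)] -/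
theorem recordOdd_of_facts {n : ℕ} (hn : 1 ≤ n) {V : Fin n → ℝ} {Vmax W : ℝ} (hV1 : ∀ j, 1 ≤ V j)
    (hVmax : ∀ j, V j ≤ Vmax) (hVmax1 : 1 ≤ Vmax) (hW : 1 ≤ W) (p : ℕ)
    {C : ℕ → ℝ} (hC0 : ∀ r, 0 ≤ C r) (hCg : ∀ r, r < n → (256 : ℝ) ^ (n - r) * C r ≤ C n)
    {L S₀ X Xf D₀ : ℕ} {D : Fin n → ℕ} {ρ K c T : ℝ}
    (hX : 1 ≤ X) (hL24 : 2 ^ (n + 24) ≤ L) (hD₀1 : 1 ≤ D₀) (hD₀q : (D₀ : ℝ) ≤ (X : ℝ) * L / 4 + 2)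
    (hXf : 2 ^ (n + 22) * X ≤ Xf) (hS : 16 * (n + 1) * L < (S₀ + 1) * (n + 2) ^ 4)
    (hD1 : ∀ j, 1 ≤ D j) (hDρ : ∀ j, (D j : ℝ) ≤ ρ / V j + 1) (hρ1 : 1 ≤ ρ)
    (hρ : ρ < (L : ℝ) / 2 ^ (n + 23))
    (hK1 : 1 ≤ K) (hc0 : 0 ≤ c) (hc : c ≤ (87 : ℝ) ^ n)
    (h3L : (3 / 2 : ℝ) * (n + 1) * L ≤ X * (c * (∏ j, V j) * K))
    (hD₀8 : (D₀ : ℝ) ≤ 8 * X * (c * (∏ j, V j) * K))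
    (h23 : (2 : ℝ) ^ (n + 23) ≤ T) (hxfT : T * X < 2 * (Xf : ℝ) + 1) (hKT : (2 : ℝ) ^ (n + 22) * K < T)
    (hΛL : ρ + Vmax ≤ (((2 : ℝ) ^ (n + 23))⁻¹ + 2 ^ n / (24 * Cb ^ n)) * L)
    (hLKΩ : (L : ℝ) ≤ (264 * Cb ^ n + 2 ^ (2 * n + 26)) * K * ∏ j, V j) :
    RecordOdd C p n V Vmax W D₀ S₀ Xf D := by
  have hL : (0 : ℝ) < (L : ℝ) := by
    have : (1 : ℝ) ≤ 2 ^ (n + 24) := one_le_pow₀ (by norm_num)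
    have h : ((2 ^ (n + 24) : ℕ) : ℝ) ≤ L := by exact_mod_cast hL24
    push_cast at h; linarith
  have hX1 : (1 : ℝ) ≤ (X : ℝ) := by exact_mod_cast hX
  have hs : (16 : ℝ) * (n + 1) * L ≤ ((S₀ : ℝ) + 1) * ((n : ℝ) + 2) ^ 4 := by
    have h : ((16 * (n + 1) * L : ℕ) : ℝ) < (((S₀ + 1) * (n + 2) ^ 4 : ℕ) : ℝ) := by exact_mod_cast hS
    push_cast at h; linarith
  have hs' : 16 * ((n : ℝ) + 1) * L < ((S₀ : ℝ) + 1) * ((n : ℝ) + 2) ^ 4 := by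
    have h : ((16 * (n + 1) * L : ℕ) : ℝ) < (((S₀ + 1) * (n + 2) ^ 4 : ℕ) : ℝ) := by exact_mod_cast hS
    push_cast at h; linarith
  -- `D₀ ≤ X L / 2`
  have hL' : (2 : ℝ) ^ (n + 24) ≤ L := by exact_mod_cast hL24
  have h224 : (2 : ℝ) ^ 24 ≤ 2 ^ (n + 24) := pow_le_pow_right₀ (by norm_num) (by omega)
  have hXL : (2 : ℝ) ^ 24 ≤ (X : ℝ) * L := by nlinarith
  have hD₀half : (D₀ : ℝ) ≤ (X : ℝ) * L / 2 := by nlinarith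
  -- the box `Λ := ρ + Vmax`
  have hΛ : ∀ j, (D j : ℝ) * V j ≤ ρ + Vmax := by
    intro j
    have hV := hV1 j
    have h1 : (D j : ℝ) * V j ≤ (ρ / V j + 1) * V j := mul_le_mul_of_nonneg_right (hDρ j) (by linarith)
    have e : (ρ / V j + 1) * V j = ρ + V j := by field_simp
    linarith [hVmax j]
  have hΛpos : 0 < ρ + Vmax := by linarith
  -- `2^{n+22} K X ≤ 2 X_f + 1`
  have hxfK : (2 : ℝ) ^ (n + 22) * K * X ≤ 2 * (Xf : ℝ) + 1 := by
    have hX0 : (0 : ℝ) ≤ X := by positivity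
    nlinarith
  refine RecordExits.recordOdd_of_ineqs hC0 hn hV1 hVmax1 (by linarith) hD₀1 hD1
    (D_le_Dmax_of hV1 hDρ hρ1 hρ) hΛ
    (exitA_of hX hD₀1 hL24 hD₀q hXf hS)
    (exitB_of hn hV1 hDρ hρ1 hρ hL hX1 hK1 hc0 hc h3L hD₀8 hD₀half hs h23 hxfT hKT hD₀1)
    (exitC_odd_of hn hV1 hVmax hVmax1 hW hL hX1 hΛpos hD₀1 hD₀half hs' hxfK hΛL hLKΩ p hC0 hCg)

/-- **`RecordTwo` from END facts only** (any admissible `C`). [cite: Nesterenko2003, §5.2 (5.13)–(5.22)] -/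
theorem recordTwo_of_facts {n : ℕ} (hn : 1 ≤ n) {V : Fin n → ℝ} {Vmax W : ℝ} (hV1 : ∀ j, 1 ≤ V j)
    (hVmax : ∀ j, V j ≤ Vmax) (hVmax1 : 1 ≤ Vmax) (hW : 1 ≤ W)
    {C : ℕ → ℝ} (hC0 : ∀ r, 0 ≤ C r) (hCg : ∀ r, r < n → (256 : ℝ) ^ (n - r) * C r ≤ C n)
    {L S₀ X Xf D₀ : ℕ} {D : Fin n → ℕ} {ρ K c T : ℝ}
    (hX : 1 ≤ X) (hL24 : 2 ^ (n + 24) ≤ L) (hD₀1 : 1 ≤ D₀) (hD₀q : (D₀ : ℝ) ≤ (X : ℝ) * L / 4 + 2)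
    (hXf : 2 ^ (n + 22) * X ≤ Xf) (hS : 16 * (n + 1) * L < (S₀ + 1) * (n + 2) ^ 4)
    (hD1 : ∀ j, 1 ≤ D j) (hDρ : ∀ j, (D j : ℝ) ≤ ρ / V j + 1) (hρ1 : 1 ≤ ρ)
    (hρ : ρ < (L : ℝ) / 2 ^ (n + 23))
    (hK1 : 1 ≤ K) (hc0 : 0 ≤ c) (hc : c ≤ (87 : ℝ) ^ n)
    (h3L : (3 / 2 : ℝ) * (n + 1) * L ≤ X * (c * (∏ j, V j) * K))
    (hD₀8 : (D₀ : ℝ) ≤ 8 * X * (c * (∏ j, V j) * K))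
    (h23 : (2 : ℝ) ^ (n + 23) ≤ T) (hxfT : T * X < 2 * (Xf : ℝ) + 1) (hKT : (2 : ℝ) ^ (n + 22) * K < T)
    (hΛL : ρ + Vmax ≤ (((2 : ℝ) ^ (n + 23))⁻¹ + 2 ^ n / (24 * Cb ^ n)) * L)
    (hLKΩ : (L : ℝ) ≤ (264 * Cb ^ n + 2 ^ (2 * n + 26)) * K * ∏ j, V j) :
    RecordTwo C n V Vmax W D₀ S₀ Xf D := by
  have hL : (0 : ℝ) < (L : ℝ) := by
    have : (1 : ℝ) ≤ 2 ^ (n + 24) := one_le_pow₀ (by norm_num)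
    have h : ((2 ^ (n + 24) : ℕ) : ℝ) ≤ L := by exact_mod_cast hL24
    push_cast at h; linarith
  have hX1 : (1 : ℝ) ≤ (X : ℝ) := by exact_mod_cast hX
  have hs : (16 : ℝ) * (n + 1) * L ≤ ((S₀ : ℝ) + 1) * ((n : ℝ) + 2) ^ 4 := by
    have h : ((16 * (n + 1) * L : ℕ) : ℝ) < (((S₀ + 1) * (n + 2) ^ 4 : ℕ) : ℝ) := by exact_mod_cast hS
    push_cast at h; linarith
  have hs' : 16 * ((n : ℝ) + 1) * L < ((S₀ : ℝ) + 1) * ((n : ℝ) + 2) ^ 4 := by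
    have h : ((16 * (n + 1) * L : ℕ) : ℝ) < (((S₀ + 1) * (n + 2) ^ 4 : ℕ) : ℝ) := by exact_mod_cast hS
    push_cast at h; linarith
  have hL' : (2 : ℝ) ^ (n + 24) ≤ L := by exact_mod_cast hL24
  have h224 : (2 : ℝ) ^ 24 ≤ 2 ^ (n + 24) := pow_le_pow_right₀ (by norm_num) (by omega)
  have hXL : (2 : ℝ) ^ 24 ≤ (X : ℝ) * L := by nlinarith
  have hD₀half : (D₀ : ℝ) ≤ (X : ℝ) * L / 2 := by nlinarith
  have hΛ : ∀ j, (D j : ℝ) * V j ≤ ρ + Vmax := by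
    intro j
    have hV := hV1 j
    have h1 : (D j : ℝ) * V j ≤ (ρ / V j + 1) * V j := mul_le_mul_of_nonneg_right (hDρ j) (by linarith)
    have e : (ρ / V j + 1) * V j = ρ + V j := by field_simp
    linarith [hVmax j]
  have hΛpos : 0 < ρ + Vmax := by linarith
  have hxfK : (2 : ℝ) ^ (n + 22) * K * X ≤ 2 * (Xf : ℝ) + 1 := by
    have hX0 : (0 : ℝ) ≤ X := by positivity
    nlinarith
  refine RecordExits.recordTwo_of_ineqs hC0 hn hV1 hVmax1 (by linarith) hD₀1 hD1
    (D_le_Dmax_of hV1 hDρ hρ1 hρ) hΛ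
    (exitA_of hX hD₀1 hL24 hD₀q hXf hS)
    (exitB_of hn hV1 hDρ hρ1 hρ hL hX1 hK1 hc0 hc h3L hD₀8 hD₀half hs h23 hxfT hKT hD₀1)
    (exitC_two_of hn hV1 hVmax hVmax1 hW hL hX1 hΛpos hD₀1 hD₀half hs' hxfK hΛL hLKΩ hC0 hCg)

end RecordExitsNumeric

end Summit.ABC.StewartYu

end
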